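import Summits.QuantumFields.YangMills.Theorems.UnitScaleTiltCoverSites
import HarnessLib

/-!
# Route `UnitScaleTilt`, crux K1 «MinimiserStabilityRegPr» (stmt-QuantumFields-19200), EX row `hGF`, the (L6) LOD line —
# **THE NO-WRAP ROOM OF THE CUBE FAMILY IS ARITHMETIC IN THE CUBE SCALE** (chair ★`ym-ust-19200-p1` g25, 2026-08-30, pin (P1) of the
# Idx-level knit `hT_allMembers`: «the LARGE predicate must imply `hwrap` by arithmetic alone, stated as its own lemma so the cover case reuses it»)

Cell `ym3-torus` (HUMAN RULING D-0037; rung R3 = SU(2) YM₃ on T³ — NOT d = 4, NOT infinite volume, NOT a mass gap, NOT Clay).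
THEOREMS ONLY (0 `def`, 0 `sorry`, default heartbeats); `--supports stmt-QuantumFields-19200 --as helper`; count-neutral.

WHAT.  px17's corner cut-off family of cube scale `s` (✓`Prop7LODCutoffDock.exists_LOD_cutoffs_corner`) and hence the (L6) member assembly
✓`Prop7LODAssemblyMember.curvedTarget_member_of_hKP_hloc` carry the NO-WRAP hypothesis
`hwrap : 2 * (3 * (L^s * L^(K−n)) + 8 * (F.P K).L^(K−n) + 1) ≤ (F.P K).sitesPerDir 0` (`sitesPerDir 0 = 2·L^{m+K}`, lit `Params.sitesPerDir`).
This file discharges it from the SCALE INEQUALITY `s + 2 ≤ F.m + n` alone (`1 ≤ s`, `n ≤ K`; `L ≥ 3` since `L` is odd and `> 1`):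
`L^{m+K} ≥ L²·L^s·L^{K−n} ≥ 9·L^s·L^{K−n} ≥ 3·L^s·L^{K−n} + 8·L^{K−n} + 1`.  So the large∕small dichotomy of the knit is ONE threshold
`s₀ L + 2 ≤ F.m + n`, and the small members go to the cover `F.cover (s₀ L + 2)` (`cover_m = m + jc` rfl), where the same lemma applies.
* ★ `wrap_room_of_scale` (`sitesPerDir 0 = 2·L^{m+K}` and `3 ≤ L` inlined by `rfl`∕`omega` — the named forms exist elsewhere in the tree) — `1 ≤ s → s + 2 ≤ F.m + n → n ≤ K → hwrap`.
* ★ `wrap_room_cover` — the same on the cover `F.cover jc` from `s + 2 ≤ F.m + jc + n`; `scale_lt_of_room` (`s + 2 ≤ F.m + n → s < F.m + n`, the knit's `hs`);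
  `cover_room` (`s + 2 ≤ F.m + (s + 2) + n` — the cover degree `jc := s + 2` is always admissible).
HONEST SCOPE.  Natural-number arithmetic; nothing of the window, `hT`, `hGF`, (3.49), EX `stub_existenceMinimalOrbit` or the crux is proved here.

References: T. Bałaban, CMP **109** (1987) 249–301 [Balaban1987RG1] ((0.1) p.251: `2L^{m+K−j}` sites per direction); CMP **99** (1985) 389–434
[Balaban1985BackgroundPropagators] ((3.100) pp.413–414: the cube partition of the IMS step).
-/

set_option autoImplicit false

namespace Summit.QuantumFields.YangMills.Theorems.Prop7LODWrapRoom

open Literature.MathematicalPhysics.QuantumFieldTheory.Balaban1983to89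
open Literature.MathematicalPhysics.QuantumFieldTheory.Balaban1983to89.T3ContinuumYM3Torus
open Summit.QuantumFields.YangMills.Theorems.CoverSites

variable (F : T3Family)

/-- The knit's `hs : s < F.m + n` from the room inequality. [folklore] -/
theorem scale_lt_of_room {s n : ℕ} (hs : s + 2 ≤ F.m + n) : s < F.m + n := by omega

/-- The cover degree `jc := s + 2` always gives the room inequality on the cover. [folklore] -/
theorem cover_room (s n : ℕ) : s + 2 ≤ (F.cover (s + 2)).m + n := by
  rw [T3Family.cover_m]; omega

/-- ★ **THE NO-WRAP ROOM FROM THE SCALE INEQUALITY**: `1 ≤ s`, `s + 2 ≤ m + n`, `n ≤ K` ⟹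
`2·(3·L^s·L^{K−n} + 8·L^{K−n} + 1) ≤ sitesPerDir 0 = 2·L^{m+K}`. [cite: Balaban1985BackgroundPropagators, (3.100) pp.413-414] -/
theorem wrap_room_of_scale {s n K : ℕ} (hs1 : 1 ≤ s) (hs : s + 2 ≤ F.m + n) (hnK : n ≤ K) :
    2 * ((3 * (F.L ^ s * F.L ^ (K - n))) + 8 * (F.P K).L ^ (K - n) + 1) ≤ (F.P K).sitesPerDir 0 := by
  -- `sitesPerDir 0 = 2·L^{m+K}` and `(F.P K).L = L`, both by `rfl` (lit `Params.sitesPerDir`, `T3Family.P`)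
  have hSP : (F.P K).sitesPerDir 0 = 2 * F.L ^ (F.m + K) := by
    show 2 * (F.P K).L ^ ((F.P K).m + (F.P K).K - 0) = 2 * F.L ^ (F.m + K)
    rfl
  have hPL : (F.P K).L = F.L := rfl
  rw [hSP, hPL]
  have hL : 3 ≤ F.L := by obtain ⟨r, hr⟩ := F.hL.1; have := F.hL.2; omega
  -- abbreviations
  have hA : 3 ≤ F.L ^ s := by
    calc 3 ≤ F.L ^ 1 := by simpa using hL
      _ ≤ F.L ^ s := Nat.pow_le_pow_right (by omega) hs1
  have hB : 1 ≤ F.L ^ (K - n) := Nat.one_le_pow _ _ (by omega)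
  -- `L^{m+K} = L^t * L^2 * L^s * L^{K-n}` with `t = (m+K) - (s+2+(K-n))`
  obtain ⟨t, ht⟩ : ∃ t, F.m + K = t + 2 + s + (K - n) := ⟨F.m + K - (s + 2 + (K - n)), by omega⟩
  rw [ht, pow_add, pow_add, pow_add]
  have hC : 1 ≤ F.L ^ t := Nat.one_le_pow _ _ (by omega)
  have hL2 : 9 ≤ F.L ^ 2 := by nlinarith
  -- now pure arithmetic in `A = L^s ≥ 3`, `B = L^{K-n} ≥ 1`, `C ≥ 1`, `L² ≥ 9`
  set A := F.L ^ s with hAdef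
  set B := F.L ^ (K - n) with hBdef
  set C := F.L ^ t with hCdef
  set Q := F.L ^ 2 with hQdef
  have h1 : 9 * (A * B) ≤ C * Q * A * B := by
    have : 9 * (A * B) ≤ (C * Q) * (A * B) := Nat.mul_le_mul_right _ (by nlinarith)
    simpa [mul_assoc] using this
  have h2 : 3 * (A * B) + 8 * B + 1 ≤ 9 * (A * B) := by nlinarith
  omega

/-- ★ **THE SAME ON THE COVER** `F.cover jc` (`cover_m = m + jc`, `cover_L = L`): room `s + 2 ≤ F.m + jc + n` ⟹ the cover member's `hwrap`.
[cite: Balaban1985BackgroundPropagators, (3.100) pp.413-414] -/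
theorem wrap_room_cover (jc : ℕ) {s n K : ℕ} (hs1 : 1 ≤ s) (hs : s + 2 ≤ F.m + jc + n) (hnK : n ≤ K) :
    2 * ((3 * ((F.cover jc).L ^ s * (F.cover jc).L ^ (K - n))) + 8 * ((F.cover jc).P K).L ^ (K - n) + 1) ≤ ((F.cover jc).P K).sitesPerDir 0 :=
  wrap_room_of_scale (F.cover jc) hs1 (by rw [T3Family.cover_m]; exact hs) hnK

end Summit.QuantumFields.YangMills.Theorems.Prop7LODWrapRoom
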